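import Summits.Ventures.HodgeRepro2.T5QuotientDescent

/-!
# T5QuotientEquivariance — (A3) STEP 1: «L^{K_f} = L²(G(F)\G(𝔸)/K_f) as unitary G_∞-modules»

Cell pub-hodge-repro2, seat p5, Tier 5 (route/T5-N4-p5.md, N4.3 (A3) STEP 1, l. 147): the
identification `invariantsEquiv : L²(X/K, mk_*μ) ≃ₗᵢ[ℂ] invariants μ` of rows 41–42 is
EQUIVARIANT for a second group `G` (= `G_∞`) acting on `X` and commuting with `K` (= `K_f`;
Mathlib's `SMulCommClass G K X`, the prose's «G_∞ commutes with K_f ⊂ G(𝔸_f)»):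

* `G` acts on the orbit space `X/K` (`instMulAction`, `g • [x] = [g • x]`), measurably
  (`instMeasurableConstSMul`) and preserving the push-forward measure
  (`instSMulInvariantMeasure`), so that row 36's regular representation of `G` on
  `L²(X/K, mk_*μ)` is defined;
* the pull-back intertwines the two regular representations (`pullback_regularRep`:
  `pullback (R_{X/K}(g) h) = R_X(g) (pullback h)`), hence so does the isomorphism
  (`coe_invariantsEquiv_regularRep`): `L^{K_f} = L²(G(F)\G(𝔸)/K_f)` as unitary `G_∞`-modules,
  with `R_X(g)` restricted to the `K`-invariants (`regularRep_mem_invariants`).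

Mathlib only besides rows 36, 41, 42.  Axioms: propext, Classical.choice, Quot.sound.
README §8(d): uses an L-value-free non-vanishing device: NO.
-/

namespace Summit.Ventures.HodgeRepro2.T5QuotientEquivariance

open MeasureTheory
open Summit.Ventures.HodgeRepro2.T5RegularRep Summit.Ventures.HodgeRepro2.T5QuotientPullback
  Summit.Ventures.HodgeRepro2.T5QuotientDescent

variable {G K X : Type*} [Group G] [Group K] [MulAction G X] [MulAction K X] [SMulCommClass G K X]

/-! ### The induced action of `G` on `X/K` -/

/-- A group `G` acting on `X` and commuting with `K` acts on the orbit space `X/K` by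
`g • [x] = [g • x]`. -/
instance instMulAction : MulAction G (MulAction.orbitRel.Quotient K X) where
  smul g q := Quotient.liftOn' q (fun x => mk K (g • x)) fun x y hxy => by
    obtain ⟨k, rfl⟩ := MulAction.mem_orbit_iff.1 (MulAction.orbitRel_apply.1 hxy)
    rw [smul_comm, mk_smul]
  one_smul q := by
    refine Quotient.inductionOn' q fun x => ?_
    show mk K ((1 : G) • x) = mk K x
    rw [one_smul]
  mul_smul g g' q := by
    refine Quotient.inductionOn' q fun x => ?_
    show mk K ((g * g') • x) = mk K (g • g' • x)
    rw [mul_smul]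

/-- The induced action on classes. -/
theorem smul_mk (g : G) (x : X) : g • mk K x = mk K (g • x) :=
  rfl

/-- The quotient map is `G`-equivariant. -/
theorem mk_comp_smul (g : G) : mk K ∘ (fun x : X => g • x) = (fun q => g • q) ∘ mk K :=
  rfl

section Measure

variable [MeasurableSpace X] (μ : Measure X) [MeasurableConstSMul G X]

/-- The induced action on `X/K` is measurable for the quotient σ-algebra. -/
instance instMeasurableConstSMul : MeasurableConstSMul G (MulAction.orbitRel.Quotient K X) where
  measurable_const_smul g :=
    measurable_from_quotient.2 ((measurable_mk (K := K) (X := X)).comp (measurable_const_smul g))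

/-- The push-forward of a `G`-invariant measure on `X` is `G`-invariant on `X/K`. -/
instance instSMulInvariantMeasure [SMulInvariantMeasure G X μ] :
    SMulInvariantMeasure G (MulAction.orbitRel.Quotient K X) (quotMeasure (K := K) μ) where
  measure_preimage_smul g s hs := by
    rw [Measure.map_apply (measurable_mk (K := K) (X := X)) (hs.preimage (measurable_const_smul g)),
      Measure.map_apply (measurable_mk (K := K) (X := X)) hs, ← Set.preimage_comp,
      ← mk_comp_smul (K := K) g, Set.preimage_comp,
      SMulInvariantMeasure.measure_preimage_smul g (measurable_mk (K := K) (X := X) hs)]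

/-! ### The pull-back intertwines the regular representations -/

variable [SMulInvariantMeasure G X μ]

/-- **«… as unitary G_∞-modules»**: the pull-back intertwines the regular representation of `G`
on `L²(X/K, mk_*μ)` with the one on `L²(X, μ)`. -/
theorem pullback_regularRep (g : G) (h : Lp ℂ 2 (quotMeasure (K := K) μ)) :
    pullback μ (regularRep (quotMeasure (K := K) μ) g h) = regularRep μ g (pullback μ h) := by
  apply Lp.ext
  have h1 : (pullback μ (regularRep (quotMeasure (K := K) μ) g h) : X → ℂ) =ᵐ[μ]
      (regularRep (quotMeasure (K := K) μ) g h : MulAction.orbitRel.Quotient K X → ℂ) ∘ mk K :=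
    coeFn_pullback μ _
  have h2 : (regularRep (quotMeasure (K := K) μ) g h : MulAction.orbitRel.Quotient K X → ℂ) ∘
      mk K =ᵐ[μ] (h ∘ fun q => g⁻¹ • q) ∘ mk K :=
    (measurePreserving_mk (K := K) μ).quasiMeasurePreserving.ae_eq_comp
      (coeFn_regularRep_apply (quotMeasure (K := K) μ) g h)
  have h3 : (regularRep μ g (pullback μ h) : X → ℂ) =ᵐ[μ] (pullback μ h) ∘ fun x => g⁻¹ • x :=
    coeFn_regularRep_apply μ g (pullback μ h)
  have h4 : ((pullback μ h : X → ℂ) ∘ fun x => g⁻¹ • x) =ᵐ[μ] (h ∘ mk K) ∘ fun x => g⁻¹ • x :=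
    (measurePreserving_smul g⁻¹ μ).quasiMeasurePreserving.ae_eq_comp (coeFn_pullback μ h)
  have h5 : ((h : MulAction.orbitRel.Quotient K X → ℂ) ∘ fun q => g⁻¹ • q) ∘ mk K =
      (h ∘ mk K) ∘ fun x => g⁻¹ • x := by
    funext x
    simp only [Function.comp_apply, smul_mk]
  refine (h1.trans (h2.trans ?_)).trans (h3.trans h4).symm
  rw [h5]

/-- The `K`-invariants are stable under the regular representation of `G`
(«L^{K_f} is G_∞-stable», row 36 v2, in this form). -/
theorem regularRep_mem_invariants [MeasurableConstSMul K X] [SMulInvariantMeasure K X μ] (g : G)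
    {f : Lp ℂ 2 μ} (hf : f ∈ invariants (K := K) μ) : regularRep μ g f ∈ invariants (K := K) μ := by
  intro k
  apply Lp.ext
  have h1 := coeFn_regularRep_apply μ k (regularRep μ g f)
  have h2 : ((regularRep μ g f : X → ℂ) ∘ fun x => k⁻¹ • x) =ᵐ[μ]
      ((f : X → ℂ) ∘ fun x => g⁻¹ • x) ∘ fun x => k⁻¹ • x :=
    (measurePreserving_smul k⁻¹ μ).quasiMeasurePreserving.ae_eq_comp
      (coeFn_regularRep_apply μ g f)
  have h3 : (((f : X → ℂ) ∘ fun x => g⁻¹ • x) ∘ fun x => k⁻¹ • x) =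
      ((f : X → ℂ) ∘ fun x => k⁻¹ • x) ∘ fun x => g⁻¹ • x := by
    funext x
    simp only [Function.comp_apply, smul_comm g⁻¹ k⁻¹ x]
  have h4 : (((f : X → ℂ) ∘ fun x => k⁻¹ • x) ∘ fun x => g⁻¹ • x) =ᵐ[μ]
      (f : X → ℂ) ∘ fun x => g⁻¹ • x :=
    (measurePreserving_smul g⁻¹ μ).quasiMeasurePreserving.ae_eq_comp
      (((mem_invariants_iff μ).1 hf k ▸ coeFn_regularRep_apply μ k f).symm)
  refine h1.trans (h2.trans ?_)
  rw [h3]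
  exact h4.trans (coeFn_regularRep_apply μ g f).symm

/-- The identification `L²(X/K) ≃ invariants μ` of rows 41–42 is `G`-equivariant on points. -/
theorem coe_invariantsEquiv_regularRep [MeasurableSpace K] [MeasurableMul K] [MeasurableSMul₂ K X]
    (μK : Measure K) [SFinite μ] [SFinite μK] [IsProbabilityMeasure μK] [μK.IsMulRightInvariant]
    [SMulInvariantMeasure K X μ] (g : G) (h : Lp ℂ 2 (quotMeasure (K := K) μ)) :
    (invariantsEquiv μK μ (regularRep (quotMeasure (K := K) μ) g h) : Lp ℂ 2 μ) =
      regularRep μ g (invariantsEquiv μK μ h : Lp ℂ 2 μ) := by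
  rw [coe_invariantsEquiv_apply, coe_invariantsEquiv_apply, pullback_regularRep]

end Measure

end Summit.Ventures.HodgeRepro2.T5QuotientEquivariance
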